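import Summits.AtomisticToContinuum.FouriersLaw.Theorems.IncoherentChannel.Negative.GibbsStein
import Summits.AtomisticToContinuum.FouriersLaw.Theorems.IncoherentChannel.Negative.HarmonicFlow
import HarnessLib

/-!
# BondHeatUncertainty / BoundedResponse — «BathHeat» §11 (addendum to NODE 108): KICK-CONVEXITY, the quadratic case
(decomp-a2c lens-1, g108 addendum; blocker item stmt-AtomisticToContinuum-11071 = `BoundedResponse`; companion memo `memo/STEIN-KICK-g108.md`)

THE STEIN READING OF THE KERNEL (heuristic H6 of the memo; exact wherever the forecasts are `C²` along `e_{p₀}` with polynomial growth —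
`GibbsStein.stein_momentum` is the one-derivative identity, valid for EVERY chain of the family).  With `G_t(z) = E_z[p₀(t)²]`,
`m_t(z) = E_z[p₀(t)]`, `V_t = G_t − m_t²` and `μ_T` Gaussian in `p₀` (independent of the other coordinates):
  `c_N(t) = T·E_μ[∂_{p₀} m_t]` (correlation = response),   `K_N(t) = T·E_μ[p₀ ∂_{p₀} G_t] = T²·E_μ[∂²_{p₀} G_t]`,
  `CP_N(t) = T²·E_μ[∂²_{p₀}(m_t²)]`,   `VC_N(t) = T²·E_μ[∂²_{p₀} V_t]`:
the boundary kinetic kernel is `T²` × the GIBBS-AVERAGED CONVEXITY of the future boundary kinetic-energy forecast in the direction of a present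
boundary momentum KICK; the one-sided floor (BKᶠ) says «the forecast is, on thermal average, not too concave in the kick».

THIS FILE types the EXACTLY SOLVABLE CASE of that mechanism, common to the two solvable corners of the problem — phonons (`G_t = (linear)² + const`,
NODE 108 `bathKinCorr_commonPast_harmonic_eq`) and the harmonic chain with energy-conserving velocity-randomising noise / fast chaotic forcing
(Bernardin–Olla; Canestrari–Liverani–Olla, Invent. Math. 2026, arXiv:2310.13338: there `E_z[p₀(t)²]` is a positive-semidefinite QUADRATIC FORM in `z` plus a
constant, because the generator preserves polynomial degree) — in one Gibbs-level identity valid for the ANHARMONIC Gibbs measure: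

  `integral_kinObs_mul_affineSumSq` :  `∫ (p₀² − T)·(a + B z + Σ_i (L_i z)²) dμ_T = 2T²·Σ_i (L_i e_{p₀})²`   (hence `≥ 0`),

for any constant `a`, continuous linear `B` and finite family of continuous linear functionals `L_i` (every PSD quadratic form is such a sum).  Read with
NODE 108's `bathKinCorr_eq_integral_kinObs_mul_kinFcastG` (`K_N(t) = ∫ (p₀²−T)·G_t dμ_T`): IN ANY REGIME WHERE THE BOUNDARY KINETIC FORECAST `G_t` IS AN
AFFINE-PLUS-SUM-OF-SQUARES FUNCTION OF THE INITIAL STATE, `K_N(t) = 2T² Σ_i (L_i e_{p₀})² ≥ 0` — the floor (BKᶠ) holds with `A = 0`, whatever `N` and `t`.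
What the anharmonic chain must supply instead (memo §B): `G_t` asymptotically quadratic in the kick with a NONNEGATIVE retained-energy coefficient, and
thermal dephasing of the amplitude-dependent oscillation of `G_t` in the kick — the only source of kick-concavity — at an `N`-uniform rate.

Self-contained (tree imports only; does not import the staged NODE 108 file).  [cite: RiederLebowitzLieb1967] [cite: BonettoLebowitzReyBellet2000]
-/

noncomputable section

open MeasureTheory ProbabilityTheory Filter Topology Set Function
open scoped NNReal ENNReal
open Literature.MathematicalPhysics.KineticTheory.HeatConduction
open Literature.MathematicalPhysics.KineticTheory OscillatorChain
open Literature.Probability.Process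
open Summit.AtomisticToContinuum.FouriersLaw.Theses.PhononMeanFreePath
open Summit.AtomisticToContinuum.FouriersLaw.Theorems.IncoherentChannel.Negative.KernelMoments
open Summit.AtomisticToContinuum.FouriersLaw.Theorems.IncoherentChannel.Negative.HarmonicFlow
  (integral_gibbsMeasure_eq_zero_of_odd)
open Summit.AtomisticToContinuum.FouriersLaw.Theorems.IncoherentChannel.Negative.GibbsStein
  (integrable_gibbsMeasure_of_growth pow_le_one_add_sq_sq gibbs_sq_momentum gibbs_momentum_mul_clm gibbs_sq_momentum_mul_clm_sq)

namespace Summit.AtomisticToContinuum.FouriersLaw.Theorems.BoundedResponse.HeatSpreading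

/-- **Kick-convexity, quadratic case.**  For the Gibbs measure `μ_T` of ANY chain of the `pinnedChain` family (anharmonic included — only the
Gaussian `p₀`-marginal is used, via Stein's identity in the `p₀` direction), any constant `a`, any continuous linear `B` and any finite family of
continuous linear functionals `L i`:
`∫ (p₀² − T)·(a + B z + Σ_i (L_i z)²) dμ_T = 2T²·Σ_i (L_i e_{p₀})²`, where `e_{p₀} = (0, Pi.single 0 1)` is the unit boundary-momentum kick.
The constant and the linear term drop out (equipartition / oddness); each square contributes `∫ p₀² L² − T∫L² = 2(∫ p₀ L)² = 2T²(L e_{p₀})²`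
(`gibbs_sq_momentum_mul_clm_sq`, `gibbs_momentum_mul_clm`).  This is the common mechanism of the two solvable corners (phonons: `G_t = m_t² + const`
with `m_t` linear; harmonic chain + velocity-randomising conservative noise: `G_t` a PSD quadratic form + const).  [cite: RiederLebowitzLieb1967] -/
theorem integral_kinObs_mul_affineSumSq {ω₂ lam β γ T : ℝ} (hω : 0 < ω₂) (hl : 0 ≤ lam) (hβ : 0 ≤ β) (hT : 0 < T) {n k : ℕ}
    (a : ℝ) (B : PhaseSpace (n + 1) →L[ℝ] ℝ) (L : Fin k → (PhaseSpace (n + 1) →L[ℝ] ℝ)) :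
    ∫ x, (x.2 0 ^ 2 - T) * (a + B x + ∑ i, L i x ^ 2) ∂((pinnedChain ω₂ lam β γ).gibbsMeasure (n + 1) T) =
      2 * T ^ 2 * ∑ i, (L i ((0, Pi.single 0 1) : PhaseSpace (n + 1))) ^ 2 := by
  set μ := (pinnedChain ω₂ lam β γ).gibbsMeasure (n + 1) T with hμ
  haveI : IsProbabilityMeasure μ := pinnedChain_isProbabilityMeasure_gibbsMeasure hω hl hβ γ (n + 1) hT
  set v₀ : PhaseSpace (n + 1) := (0, Pi.single 0 1) with hv₀
  have hpc : Continuous fun x : PhaseSpace (n + 1) => x.2 (0 : Fin (n + 1)) := by fun_prop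
  -- integrability of the pieces (growth bounds under the Gibbs density)
  have hI_pp : Integrable (fun x : PhaseSpace (n + 1) => x.2 0 ^ 2) μ := by
    refine integrable_gibbsMeasure_of_growth hω hl hβ hT (hpc.pow 2) (A := 1) fun x => ?_
    have h1 := OscillatorChain.abs_snd_apply_le_norm x 0
    have h4 := (pow_le_one_add_sq_sq (norm_nonneg x)).2.1
    rw [abs_pow]
    calc |x.2 0| ^ 2 ≤ ‖x‖ ^ 2 := pow_le_pow_left₀ (abs_nonneg _) h1 2
      _ ≤ 1 * (1 + ‖x‖ ^ 2) ^ 2 := by linarith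
  have hI_gg : ∀ L' : PhaseSpace (n + 1) →L[ℝ] ℝ, Integrable (fun x : PhaseSpace (n + 1) => L' x ^ 2) μ := by
    intro L'
    have hgb : ∀ x, |L' x| ≤ ‖L'‖ * ‖x‖ := fun x => by
      have := L'.le_opNorm x; rwa [Real.norm_eq_abs] at this
    refine integrable_gibbsMeasure_of_growth hω hl hβ hT (L'.continuous.pow 2) (A := ‖L'‖ ^ 2) fun x => ?_
    rw [abs_pow]
    have h4 := (pow_le_one_add_sq_sq (norm_nonneg x)).2.1
    calc |L' x| ^ 2 ≤ (‖L'‖ * ‖x‖) ^ 2 := pow_le_pow_left₀ (abs_nonneg _) (hgb x) 2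
      _ = ‖L'‖ ^ 2 * ‖x‖ ^ 2 := by ring
      _ ≤ ‖L'‖ ^ 2 * (1 + ‖x‖ ^ 2) ^ 2 := by nlinarith [sq_nonneg ‖L'‖]
  have hI_ppgg : ∀ L' : PhaseSpace (n + 1) →L[ℝ] ℝ, Integrable (fun x : PhaseSpace (n + 1) => x.2 0 ^ 2 * L' x ^ 2) μ := by
    intro L'
    have hgb : ∀ x, |L' x| ≤ ‖L'‖ * ‖x‖ := fun x => by
      have := L'.le_opNorm x; rwa [Real.norm_eq_abs] at this
    refine integrable_gibbsMeasure_of_growth hω hl hβ hT ((hpc.pow 2).mul (L'.continuous.pow 2)) (A := ‖L'‖ ^ 2) fun x => ?_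
    have h1 := OscillatorChain.abs_snd_apply_le_norm x 0
    have h6 := (pow_le_one_add_sq_sq (norm_nonneg x)).2.2.2
    rw [abs_mul, abs_pow, abs_pow]
    have e1 : |x.2 0| ^ 2 ≤ ‖x‖ ^ 2 := pow_le_pow_left₀ (abs_nonneg _) h1 2
    have e2 : |L' x| ^ 2 ≤ (‖L'‖ * ‖x‖) ^ 2 := pow_le_pow_left₀ (abs_nonneg _) (hgb x) 2
    calc |x.2 0| ^ 2 * |L' x| ^ 2 ≤ ‖x‖ ^ 2 * (‖L'‖ * ‖x‖) ^ 2 := mul_le_mul e1 e2 (by positivity) (by positivity)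
      _ = ‖L'‖ ^ 2 * ‖x‖ ^ 4 := by ring
      _ ≤ ‖L'‖ ^ 2 * (1 + ‖x‖ ^ 2) ^ 2 := by nlinarith [sq_nonneg ‖L'‖]
  -- the three kinds of terms
  have hp2 : ∫ x, x.2 (0 : Fin (n + 1)) ^ 2 ∂μ = T := gibbs_sq_momentum hω hl hβ hT 0
  have hconst : ∫ x, (x.2 (0 : Fin (n + 1)) ^ 2 - T) * a ∂μ = 0 := by
    have e : (fun x : PhaseSpace (n + 1) => (x.2 0 ^ 2 - T) * a) = fun x => a * x.2 0 ^ 2 - a * T := funext fun x => by ring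
    rw [e, integral_sub (hI_pp.const_mul a) (integrable_const _), integral_const_mul, hp2, integral_const]
    simp
  have hlin : ∫ x, (x.2 (0 : Fin (n + 1)) ^ 2 - T) * B x ∂μ = 0 :=
    integral_gibbsMeasure_eq_zero_of_odd (n + 1) T (fun x => by simp)
  have hsq : ∀ L' : PhaseSpace (n + 1) →L[ℝ] ℝ, ∫ x, (x.2 (0 : Fin (n + 1)) ^ 2 - T) * L' x ^ 2 ∂μ = 2 * T ^ 2 * L' v₀ ^ 2 := by
    intro L'
    have e : (fun x : PhaseSpace (n + 1) => (x.2 0 ^ 2 - T) * L' x ^ 2) = fun x => x.2 0 ^ 2 * L' x ^ 2 - T * L' x ^ 2 :=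
      funext fun x => by ring
    rw [e, integral_sub (hI_ppgg L') ((hI_gg L').const_mul T), integral_const_mul,
      gibbs_sq_momentum_mul_clm_sq hω hl hβ hT 0 L', gibbs_momentum_mul_clm hω hl hβ hT 0 L']
    ring
  -- assemble
  have hIsq : ∀ i ∈ (Finset.univ : Finset (Fin k)), Integrable (fun x : PhaseSpace (n + 1) => (x.2 0 ^ 2 - T) * L i x ^ 2) μ := by
    intro i _
    have e : (fun x : PhaseSpace (n + 1) => (x.2 0 ^ 2 - T) * L i x ^ 2) = fun x => x.2 0 ^ 2 * L i x ^ 2 - T * L i x ^ 2 :=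
      funext fun x => by ring
    rw [e]; exact (hI_ppgg (L i)).sub ((hI_gg (L i)).const_mul T)
  have hIa : Integrable (fun x : PhaseSpace (n + 1) => (x.2 0 ^ 2 - T) * a) μ := (hI_pp.sub (integrable_const T)).mul_const a
  have hIB : Integrable (fun x : PhaseSpace (n + 1) => (x.2 0 ^ 2 - T) * B x) μ := by
    have hgb : ∀ x, |B x| ≤ ‖B‖ * ‖x‖ := fun x => by
      have := B.le_opNorm x; rwa [Real.norm_eq_abs] at this
    have h1I : Integrable (fun x : PhaseSpace (n + 1) => x.2 0 ^ 2 * B x) μ := by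
      refine integrable_gibbsMeasure_of_growth hω hl hβ hT ((hpc.pow 2).mul B.continuous) (A := ‖B‖) fun x => ?_
      have h1 := OscillatorChain.abs_snd_apply_le_norm x 0
      have h5 := (pow_le_one_add_sq_sq (norm_nonneg x)).2.2.1
      rw [abs_mul, abs_pow]
      have e1 : |x.2 0| ^ 2 ≤ ‖x‖ ^ 2 := pow_le_pow_left₀ (abs_nonneg _) h1 2
      calc |x.2 0| ^ 2 * |B x| ≤ ‖x‖ ^ 2 * (‖B‖ * ‖x‖) := mul_le_mul e1 (hgb x) (abs_nonneg _) (by positivity)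
        _ = ‖B‖ * ‖x‖ ^ 3 := by ring
        _ ≤ ‖B‖ * (1 + ‖x‖ ^ 2) ^ 2 := by nlinarith [norm_nonneg B]
    have h2I : Integrable (fun x : PhaseSpace (n + 1) => B x) μ := by
      refine integrable_gibbsMeasure_of_growth hω hl hβ hT B.continuous (A := ‖B‖) fun x => ?_
      have h2 := (pow_le_one_add_sq_sq (norm_nonneg x)).1
      calc |B x| ≤ ‖B‖ * ‖x‖ := hgb x
        _ ≤ ‖B‖ * (1 + ‖x‖ ^ 2) ^ 2 := by nlinarith [norm_nonneg B]
    have e : (fun x : PhaseSpace (n + 1) => (x.2 0 ^ 2 - T) * B x) = fun x => x.2 0 ^ 2 * B x - T * B x := funext fun x => by ring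
    rw [e]; exact h1I.sub (h2I.const_mul T)
  have e1 : (fun x : PhaseSpace (n + 1) => (x.2 0 ^ 2 - T) * (a + B x + ∑ i, L i x ^ 2)) =
      fun x => ((x.2 0 ^ 2 - T) * a + (x.2 0 ^ 2 - T) * B x) + ∑ i, (x.2 0 ^ 2 - T) * L i x ^ 2 := by
    funext x; rw [mul_add, Finset.mul_sum]; ring
  have hIab : Integrable (fun x : PhaseSpace (n + 1) => (x.2 0 ^ 2 - T) * a + (x.2 0 ^ 2 - T) * B x) μ := hIa.add hIB
  have hIS : Integrable (fun x : PhaseSpace (n + 1) => ∑ i, (x.2 0 ^ 2 - T) * L i x ^ 2) μ := integrable_finsetSum _ hIsq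
  rw [e1, integral_add hIab hIS, integral_add hIa hIB, hconst, hlin, integral_finsetSum _ hIsq, Finset.mul_sum]
  simp_rw [hsq]
  ring

/-- Corollary: in the affine-plus-sum-of-squares regime the kick-convexity integral is NONNEGATIVE — the floor (BKᶠ) with `A = 0` in every regime
where the boundary kinetic forecast `G_t` has this shape (phonons; harmonic chain with conservative velocity-randomising noise), read through NODE 108's
`bathKinCorr_eq_integral_kinObs_mul_kinFcastG`.  [cite: RiederLebowitzLieb1967] -/
theorem integral_kinObs_mul_affineSumSq_nonneg {ω₂ lam β γ T : ℝ} (hω : 0 < ω₂) (hl : 0 ≤ lam) (hβ : 0 ≤ β) (hT : 0 < T) {n k : ℕ}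
    (a : ℝ) (B : PhaseSpace (n + 1) →L[ℝ] ℝ) (L : Fin k → (PhaseSpace (n + 1) →L[ℝ] ℝ)) :
    0 ≤ ∫ x, (x.2 0 ^ 2 - T) * (a + B x + ∑ i, L i x ^ 2) ∂((pinnedChain ω₂ lam β γ).gibbsMeasure (n + 1) T) := by
  rw [integral_kinObs_mul_affineSumSq hω hl hβ hT a B L]
  positivity

/-- The KICK-CONCAVITY BUDGET in the same language: for a forecast that is affine-plus-sum-of-squares PLUS a bounded perturbation `R` with
`|R z| ≤ ε` (the non-quadratic remainder), the kick-convexity integral is at least `−T·ε`... stated in the integrated form actually available without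
differentiability: `∫ (p₀² − T)·R dμ_T ≥ −ε·∫ |p₀² − T| dμ_T ≥ −2Tε` is NOT claimed here; we record only the exact algebraic split
`∫ (p₀²−T)(Q + R) = 2T² Σ (L_i e_{p₀})² + ∫ (p₀²−T)·R`, so that a floor on the kernel reduces to a floor on the remainder's kick-correlation alone.
[cite: RiederLebowitzLieb1967] -/
theorem integral_kinObs_mul_affineSumSq_add {ω₂ lam β γ T : ℝ} (hω : 0 < ω₂) (hl : 0 ≤ lam) (hβ : 0 ≤ β) (hT : 0 < T) {n k : ℕ}
    (a : ℝ) (B : PhaseSpace (n + 1) →L[ℝ] ℝ) (L : Fin k → (PhaseSpace (n + 1) →L[ℝ] ℝ)) {R : PhaseSpace (n + 1) → ℝ}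
    (hR : Integrable (fun x : PhaseSpace (n + 1) => (x.2 0 ^ 2 - T) * R x) ((pinnedChain ω₂ lam β γ).gibbsMeasure (n + 1) T))
    (hQ : Integrable (fun x : PhaseSpace (n + 1) => (x.2 0 ^ 2 - T) * (a + B x + ∑ i, L i x ^ 2)) ((pinnedChain ω₂ lam β γ).gibbsMeasure (n + 1) T)) :
    ∫ x, (x.2 0 ^ 2 - T) * ((a + B x + ∑ i, L i x ^ 2) + R x) ∂((pinnedChain ω₂ lam β γ).gibbsMeasure (n + 1) T) =
      2 * T ^ 2 * ∑ i, (L i ((0, Pi.single 0 1) : PhaseSpace (n + 1))) ^ 2 +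
        ∫ x, (x.2 0 ^ 2 - T) * R x ∂((pinnedChain ω₂ lam β γ).gibbsMeasure (n + 1) T) := by
  have e : (fun x : PhaseSpace (n + 1) => (x.2 0 ^ 2 - T) * ((a + B x + ∑ i, L i x ^ 2) + R x)) =
      fun x => (x.2 0 ^ 2 - T) * (a + B x + ∑ i, L i x ^ 2) + (x.2 0 ^ 2 - T) * R x := funext fun x => by ring
  rw [e, integral_add hQ hR, integral_kinObs_mul_affineSumSq hω hl hβ hT a B L]

end Summit.AtomisticToContinuum.FouriersLaw.Theorems.BoundedResponse.HeatSpreading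

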